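import Mathlib.Data.Nat.Squarefree
import Mathlib.Algebra.Polynomial.Eval.Defs
import Literature.NumberTheory.Sieve.BombieriAsymptoticSieveLeibniz

/-!
# SoloInformedLambdaKValues — `Λ_k(m) = k! ∏_{p ∣ m} log p` when `ω(m) = k`

Solo unit `solo-Parity-informed` (ideation tier, informed mode), session 16; `PLAN.md` §24.2, CLAIMS C69.

The generalised von Mangoldt function `Λ_k = μ ⋆ log^k` (`Literature.NumberTheory.Sieve.generalizedVonMangoldt`)
vanishes on integers with more than `k` prime factors (in the tree).  On integers with EXACTLY `k` prime factors it is
explicit, whatever the exponents: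

* `generalizedVonMangoldt_eq_of_card_primeFactors` — `ω(m) = k, m ≠ 0 ⟹ Λ_k(m) = k! · ∏_{p ∣ m} log p`
  (induction on `k`: split off one prime power `p^a ‖ m`, expand `Λ_k(p^a m')` by the coprime multiplicativity
  `generalizedVonMangoldt_mul_of_coprime'`; only the term `Λ_1(p^a) Λ_{k-1}(m')` survives);
* `generalizedVonMangoldt_prod_distinct_primes` — for pairwise distinct primes `q_i` (`i ∈ ι`, `k = card ι`):
  `Λ_k(∏ q_i) = k! ∏ log q_i`;
* `generalizedVonMangoldt_prod_eval_natAbs` — for a family `f : ι → ℤ[X]` and an `n` at which the `|fᵢ(n)|` are pairwise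
  distinct primes: `Λ_k(|∏ᵢ fᵢ(n)|) = k! ∏ᵢ log |fᵢ(n)|`.

This is the pointwise identity behind the `ψ_k`-form of Bateman–Horn for systems (`SoloInformedSystemPsiK`).
Elementary (Mathlib + the tree's `Λ_k` algebra).
-/

namespace Summit.Parity.BatemanHorn.Theorems

open Finset ArithmeticFunction Polynomial
open Literature.NumberTheory.Sieve (generalizedVonMangoldt generalizedVonMangoldt_zero generalizedVonMangoldt_one
  generalizedVonMangoldt_zero_apply_of_ne_one
  generalizedVonMangoldt_mul_of_coprime' generalizedVonMangoldt_eq_zero_of_lt_card_primeFactors)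

/-- `Λ_1(p^a) = log p` (`p` prime, `a ≥ 1`). -/
theorem generalizedVonMangoldt_one_primePow {p a : ℕ} (hp : p.Prime) (ha : a ≠ 0) :
    generalizedVonMangoldt 1 (p ^ a) = Real.log p := by
  rw [generalizedVonMangoldt_one, vonMangoldt_apply_pow ha, vonMangoldt_apply_prime hp]

/-- **`Λ_k(m) = k! · ∏_{p ∣ m} log p` whenever `m ≠ 0` has exactly `k` distinct prime factors.** -/
theorem generalizedVonMangoldt_eq_of_card_primeFactors :
    ∀ (k m : ℕ), m ≠ 0 → m.primeFactors.card = k →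
      generalizedVonMangoldt k m = (k.factorial : ℝ) * ∏ p ∈ m.primeFactors, Real.log p := by
  intro k
  induction k with
  | zero =>
    intro m hm hcard
    have h1 : m = 1 := by
      rcases Nat.primeFactors_eq_empty.mp (Finset.card_eq_zero.mp hcard) with h | h
      · exact absurd h hm
      · exact h
    subst h1
    rw [generalizedVonMangoldt_zero]
    simp
  | succ k ih =>
    intro m hm hcard
    obtain ⟨p, hp⟩ : m.primeFactors.Nonempty := by
      rw [← Finset.card_pos, hcard]
      exact Nat.succ_pos k
    have hpp : p.Prime := Nat.prime_of_mem_primeFactors hp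
    have hpm : p ∣ m := Nat.dvd_of_mem_primeFactors hp
    have ha0 : m.factorization p ≠ 0 := (hpp.factorization_pos_of_dvd hm hpm).ne'
    have hdecomp : p ^ m.factorization p * (m / p ^ m.factorization p) = m :=
      Nat.ordProj_mul_ordCompl_eq_self m p
    have hcop : (p ^ m.factorization p).Coprime (m / p ^ m.factorization p) :=
      (Nat.coprime_ordCompl hpp hm).pow_left _
    have hm'0 : m / p ^ m.factorization p ≠ 0 := by
      intro h
      rw [h, mul_zero] at hdecomp
      exact hm hdecomp.symm
    have hpf : (m / p ^ m.factorization p).primeFactors = m.primeFactors.erase p := by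
      rw [← Nat.support_factorization, Nat.factorization_ordCompl, Finsupp.support_erase,
        Nat.support_factorization]
    have hcard' : (m / p ^ m.factorization p).primeFactors.card = k := by
      rw [hpf, Finset.card_erase_of_mem hp, hcard, Nat.add_sub_cancel]
    have hpa1 : p ^ m.factorization p ≠ 1 := (Nat.one_lt_pow ha0 hpp.one_lt).ne'
    rw [show generalizedVonMangoldt (k + 1) m
        = generalizedVonMangoldt (k + 1) (p ^ m.factorization p * (m / p ^ m.factorization p)) by
          rw [hdecomp],
      generalizedVonMangoldt_mul_of_coprime' hcop (k + 1), Finset.sum_eq_single 1]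
    · rw [Nat.choose_one_right, generalizedVonMangoldt_one_primePow hpp ha0, Nat.add_sub_cancel,
        ih _ hm'0 hcard', hpf, Nat.factorial_succ, ← Finset.mul_prod_erase _ _ hp]
      push_cast
      ring
    · intro j hj hj1
      rcases Nat.lt_or_ge j 1 with h | h
      · have h0 : j = 0 := by omega
        rw [h0, generalizedVonMangoldt_zero_apply_of_ne_one hpa1]
        ring
      · have hjr := Finset.mem_range.mp hj
        have hlt : k + 1 - j < (m / p ^ m.factorization p).primeFactors.card := by
          rw [hcard']
          omega
        rw [generalizedVonMangoldt_eq_zero_of_lt_card_primeFactors hlt]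
        ring
    · intro h
      exact absurd (Finset.mem_range.mpr (by omega)) h

/-- **`Λ_k(∏ᵢ qᵢ) = k! ∏ᵢ log qᵢ`** for pairwise distinct primes `qᵢ`, `k = card ι`. -/
theorem generalizedVonMangoldt_prod_distinct_primes {ι : Type*} [Fintype ι] {q : ι → ℕ}
    (hq : ∀ i, (q i).Prime) (hinj : Function.Injective q) :
    generalizedVonMangoldt (Fintype.card ι) (∏ i, q i)
      = ((Fintype.card ι).factorial : ℝ) * ∏ i, Real.log (q i) := by
  classical
  have hprod : ∏ p ∈ univ.image q, p = ∏ i, q i := prod_image fun i _ j _ h => hinj h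
  have hpf : (∏ i, q i).primeFactors = univ.image q := by
    rw [← hprod, Nat.primeFactors_prod]
    intro p hp
    obtain ⟨i, -, rfl⟩ := mem_image.mp hp
    exact hq i
  have hne : ∏ i, q i ≠ 0 := prod_ne_zero_iff.mpr fun i _ => (hq i).ne_zero
  have hcard : (∏ i, q i).primeFactors.card = Fintype.card ι := by
    rw [hpf, card_image_of_injective _ hinj, card_univ]
  rw [generalizedVonMangoldt_eq_of_card_primeFactors _ _ hne hcard, hpf,
    prod_image fun i _ j _ h => hinj h]

/-- **`Λ_k(|∏ᵢ fᵢ(n)|) = k! ∏ᵢ log |fᵢ(n)|`** at every `n` where the `|fᵢ(n)|` are pairwise distinct primes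
(`f : ι → ℤ[X]`, `k = card ι`). -/
theorem generalizedVonMangoldt_prod_eval_natAbs {ι : Type*} [Fintype ι] (f : ι → ℤ[X]) {n : ℤ}
    (hprime : ∀ i, Nat.Prime ((f i).eval n).natAbs)
    (hinj : Function.Injective fun i => ((f i).eval n).natAbs) :
    generalizedVonMangoldt (Fintype.card ι) ((∏ i, f i).eval n).natAbs
      = ((Fintype.card ι).factorial : ℝ) * ∏ i, Real.log ((((f i).eval n).natAbs : ℕ) : ℝ) := by
  rw [eval_prod, show (∏ i, (f i).eval n).natAbs = ∏ i, ((f i).eval n).natAbs from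
    map_prod Int.natAbsHom (fun i => (f i).eval n) univ]
  exact generalizedVonMangoldt_prod_distinct_primes hprime hinj

end Summit.Parity.BatemanHorn.Theorems
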